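import Summits.AtomisticToContinuum.Crystallization.Theses.PalmUnimodularRigidity
import Summits.AtomisticToContinuum.Crystallization.Theorems.ShellsToBarlowChart.Negative.ScaleWindow
import Summits.AtomisticToContinuum.Crystallization.Theorems.PalmUnimodularRigidityShellsToBarlowChartDefs
import Summits.AtomisticToContinuum.Crystallization.Theorems.PalmUnimodularRigidityShellsToBarlowChartTransportDefs
import Summits.AtomisticToContinuum.Crystallization.Theorems.PalmUnimodularRigidityShellsToBarlowChartLocalCharts
import Summits.AtomisticToContinuum.Crystallization.Theorems.PalmUnimodularRigidityShellsToBarlowChartQuotientGrowth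
import Summits.AtomisticToContinuum.Crystallization.Theorems.PalmUnimodularRigidityShellsToBarlowChartDeckTransitive
import Summits.AtomisticToContinuum.Crystallization.Theorems.PalmUnimodularRigidityShellsToBarlowChartDevelopCovering
import Summits.AtomisticToContinuum.Crystallization.Theorems.PalmUnimodularRigidityShellsToBarlowChartPowerTranslation
import Summits.AtomisticToContinuum.Crystallization.Theorems.PalmUnimodularRigidityShellsToBarlowChartCubicGrowth
import Summits.AtomisticToContinuum.Crystallization.Theorems.PalmUnimodularRigidityShellsToBarlowChartTransportFinal

/-!
# Skeleton line `develop-the-model-growth-descent` — crux `ShellsToBarlowChart`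
# (stmt-AtomisticToContinuum-9227, route `PalmUnimodularRigidity`, sub-problem `Crystallization`)

Idea (card `Ideas/develop-the-model-growth-descent.md`, triage r1-1/2/3: pass): develop the
MODEL into `S` — a bond-graph covering `Ψ : barlowStacking 1 √(2/3) s → S` built by Hales's layer
induction run on the simply connected ideal stacking (layers are honest lattices `ℤ²`) — and then
kill the deck group by COUNTING: a non-trivial deck transformation has a power that is a non-zero
translation `τ` of the stacking, so the window-graph balls of `S = Ψ(B)` grow at most
quadratically, whereas the hard core `0.891`, the covering radius `≤ 0.7215` and greedy
quasi-geodesics force cubic growth.  Hence `Ψ` is injective, i.e. the bond isomorphism of the crux.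

Seven registered stubs (`stub_*`, now all LANDED as theorems of the `Theorems.PalmUnimodularRigidityShellsToBarlowChart*` files and merely re-exported here; the planner's `stub_modelCovering` = `stub_developCovering ∘ stub_transportSystem`, reshaped by the lead in cycle 1), the kernel-checked
composition `barlowChart_of_stubs : stub₁ → ⋯ → stub₆ → ∀ S, S.Nonempty → GoodShells S → BarlowChart S`
(hypotheses = the six stub statements verbatim; proof real, no `sorry`), and the skeleton theorem
`ShellsToBarlowChart_of : ShellsToBarlowChart` (the crux BY NAME, obtained by feeding the six registered
stubs to the composition through `shellsToBarlowChart_iff_scaled : … := Iff.rfl`; the whole file is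
now `sorry`-free, so it closes the crux):

* `stub_localCharts`      (M)  — the four margins: window graph = shell graph, links exact.
* `stub_transportSystem`  (XL, HARDEST) — the geometric front end: commuting frame transports
                                 `I, J, V` with parity on the every-point-good set (lead reshape of
                                 the former `stub_modelCovering`, cycle 1).
* `stub_developCovering`  (M)  — the algebraic front end: a transport system gives a Hägg word
                                 and a star-bijective, link-faithful, surjective bond covering.
* `stub_deckTransitive`   (L)  — the universal-cover step (triage r1-2/r1-3 sharpening): the
                                 flag complex of the stacking is simply connected, so a
                                 coincidence `Ψ p = Ψ p'`, `p ≠ p'`, is realised by a FIXED-POINT-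
                                 FREE contact-graph automorphism `σ` of the stacking over `Ψ`.
* `stub_powerTranslation` (M)  — torsion + Bieberbach on the model: a contact automorphism moving
                                 every site by graph distance `≥ 3` has a power equal to a
                                 non-zero translation preserving the stacking.
* `stub_quotientGrowth`   (M)  — `τ`-invariant star-surjective `Ψ` ⇒ quadratic growth of the
                                 window-graph balls of `S` around `Ψ p`.
* `stub_cubicGrowth`      (M)  — every-point-good `S` has `(n/6)³ ≤ #Ball_n(x)` for `n ≥ 12`.

Disproof used (landed negatives, namespace `…Theorems.ShellsToBarlowChartNegative`; `Negative/ScaleWindow`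
is imported and its four lemmas are restated by `example` in § Disproof ledger below; `Negative/Tolerance`
(`shellsToBarlowChart_false_tol_eighth`, `equatorPropagation_margin`, `capClash_lt_hardCore`,
`hardCore_bounds`) is cited by name only — the farm had not yet built that module at check time,
the lead should add the import once it is built):
`shellsToBarlowChart_false_without_nonempty` — `S.Nonempty` is consumed by `stub_modelCovering`
(`MapsTo Ψ B S` is impossible for `S = ∅`); `…_false_without_scaleUpper/Lower`,
`…_false_tol_eighth` — the window `[9/10,1]` and the tolerance `1/100` enter through the bond-window
identification of `stub_localCharts` (margins `1.01a ≤ 28/25 < 1.25a`, `1.02a ≤ 28/25 < (√2−0.02)a`);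
`…_false_subshell` — exclusivity `↑T = shell` is consumed by `stub_localCharts` (bonded ⇒ shell),
`stub_cubicGrowth` (hard core / covering radius) and the occupancy lemma inside `stub_modelCovering`;
`not_shellsToFccChart` — the Hägg word stays existential (read from parities on the model).
No stub is an instance of a landed Negative lemma: every stub keeps `S.Nonempty`, the window
`[9/10, 1]` (via `GoodShells`), the full-shell identity and tolerance `1/100` exactly as the crux.
-/

noncomputable section

namespace Summit.AtomisticToContinuum.Crystallization.Cruxes.ShellsToBarlowChart.DevelopTheModelGrowthDescent

open Literature.Geometry.DiscreteGeometry Literature.MathematicalPhysics.StatisticalMechanics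
open Summit.AtomisticToContinuum.Crystallization.Theses.PalmUnimodularRigidity
open Summit.AtomisticToContinuum.Crystallization.Theorems.ShellsToBarlowChartNegative

/-! ## Vocabulary
All vocabulary (`GoodShells, IsBond, bondNbrs, contacts, windowGraph, windowBall, LocalChart,
IsBondCovering, IsContactAut`, and the lead's `TransportSystem`) now lives in the LANDED Theorems
modules `PalmUnimodularRigidityShellsToBarlowChartDefs` / `…TransportDefs` (p80780, p81999) and is
opened here, so the registered stub signatures below are textually unchanged and the landed stub
files (`…LocalCharts`, `…QuotientGrowth`, …) plug in by name. -/

open Summit.AtomisticToContinuum.Crystallization.Theorems.PalmUnimodularRigidityShellsToBarlowChart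

/-! ## Disproof ledger: the landed negatives this line answers to (imports are live) -/

/-- H = `S.Nonempty` is load-bearing — consumed by `stub_modelCovering` (`MapsTo Ψ B ∅` is absurd). -/
example : ¬ ∀ S : Set (EuclideanSpace ℝ (Fin 3)), (∀ x ∈ S, GoodShellAt (9 / 10) 1 S x) → BarlowChart S :=
  shellsToBarlowChart_false_without_nonempty

/-- H = upper scale bound `a ≤ 1` — consumed by `stub_localCharts` (`1.01·a ≤ 28/25`). -/
example : ¬ ShellsToBarlowChartScaled (9 / 10) 2 := shellsToBarlowChart_false_without_scaleUpper

/-- H = lower scale bound `9/10 ≤ a` — consumed by `stub_localCharts` (`28/25 < (√2 − 0.02)·a`). -/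
example : ¬ ShellsToBarlowChartScaled (1 / 2) 1 := shellsToBarlowChart_false_without_scaleLower

/-- H = exclusivity `↑T = shell` — consumed by `stub_localCharts` (bonded ⇒ shell point),
`stub_cubicGrowth` (hard core, covering radius) and the occupancy lemma of `stub_modelCovering`. -/
example := shellsToBarlowChart_false_subshell

/-- Calibration (non-vacuity): the model itself satisfies the hypothesis, so `stub_modelCovering`
with `Ψ = id` is the exact case and no stub can exclude ideal stackings. -/
example {s : ℤ → ℤ} (hs : IsHaggSeq s) :
    ∀ x ∈ barlowStacking 1 (1 * Real.sqrt (2 / 3)) s,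
      GoodShellAt (9 / 10) 1 (barlowStacking 1 (1 * Real.sqrt (2 / 3)) s) x :=
  (hypothesis_barlowStacking hs (by norm_num) le_rfl).2

/-! ## The seven stubs: all landed under `Theorems.PalmUnimodularRigidityShellsToBarlowChart*` (referenced below by their fully qualified names) -/

/-! ## The composition (kernel-checked, no `sorry`) -/

/-- **The six stub statements imply the crux, pointwise** (hypotheses are the stub statements
verbatim; `GoodShells S` / `BarlowChart S` are the landed parametrisation of the crux hypothesis /
conclusion, definitionally the crux: `shellsToBarlowChart_iff_scaled`).  Logic of the descent:
develop the model (`stub 1, 2`); if `Ψ p = Ψ p'` with `p ≠ p'`, a site-free deck automorphism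
exists (`stub 3`), it moves every site by graph distance `≥ 3` because `Ψ` is injective on closed
stars and on contacts of a common site, so a power of it is a non-zero period `τ` of the model
over `Ψ` (`stub 4`); then balls of `S` grow at most quadratically (`stub 5`) and at least
cubically (`stub 6`) — contradiction for `n > 216 K + 216`.  So `Ψ` is a bijection, and
bond-faithfulness is star-bijectivity plus injectivity. -/
theorem barlowChart_of_stubs
    (h₁ : ∀ S : Set (EuclideanSpace ℝ (Fin 3)), GoodShells S → ∀ x ∈ S, LocalChart S x)
    (h₂ : ∀ S : Set (EuclideanSpace ℝ (Fin 3)), S.Nonempty → GoodShells S → (∀ x ∈ S, LocalChart S x) →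
      ∃ s : ℤ → ℤ, IsHaggSeq s ∧ ∃ Ψ : (EuclideanSpace ℝ (Fin 3)) → (EuclideanSpace ℝ (Fin 3)), IsBondCovering S s Ψ)
    (h₃ : ∀ (S : Set (EuclideanSpace ℝ (Fin 3))) (s : ℤ → ℤ) (Ψ : (EuclideanSpace ℝ (Fin 3)) → (EuclideanSpace ℝ (Fin 3))), IsHaggSeq s → IsBondCovering S s Ψ →
      ∀ p ∈ barlowStacking 1 (Real.sqrt (2 / 3)) s, ∀ p' ∈ barlowStacking 1 (Real.sqrt (2 / 3)) s, Ψ p = Ψ p' → p ≠ p' →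
        ∃ σ : (EuclideanSpace ℝ (Fin 3)) → (EuclideanSpace ℝ (Fin 3)), IsContactAut s σ ∧ (∀ q ∈ barlowStacking 1 (Real.sqrt (2 / 3)) s, Ψ (σ q) = Ψ q) ∧ σ p = p' ∧
          ∀ q ∈ barlowStacking 1 (Real.sqrt (2 / 3)) s, σ q ≠ q)
    (h₄ : ∀ (s : ℤ → ℤ) (σ : (EuclideanSpace ℝ (Fin 3)) → (EuclideanSpace ℝ (Fin 3))), IsHaggSeq s → IsContactAut s σ →
      (∀ q ∈ barlowStacking 1 (Real.sqrt (2 / 3)) s, σ q ≠ q) →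
      (∀ q ∈ barlowStacking 1 (Real.sqrt (2 / 3)) s, dist q (σ q) ≠ 1) →
      (∀ q ∈ barlowStacking 1 (Real.sqrt (2 / 3)) s, ∀ m ∈ barlowStacking 1 (Real.sqrt (2 / 3)) s, dist q m = 1 → dist m (σ q) ≠ 1) →
        ∃ τ : (EuclideanSpace ℝ (Fin 3)), τ ≠ 0 ∧ (∀ q ∈ barlowStacking 1 (Real.sqrt (2 / 3)) s, q + τ ∈ barlowStacking 1 (Real.sqrt (2 / 3)) s ∧ q - τ ∈ barlowStacking 1 (Real.sqrt (2 / 3)) s) ∧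
          ∃ n : ℕ, ∀ q ∈ barlowStacking 1 (Real.sqrt (2 / 3)) s, σ^[n] q = q + τ)
    (h₅ : ∀ (S : Set (EuclideanSpace ℝ (Fin 3))) (s : ℤ → ℤ) (Ψ : (EuclideanSpace ℝ (Fin 3)) → (EuclideanSpace ℝ (Fin 3))) (τ : (EuclideanSpace ℝ (Fin 3))), IsHaggSeq s →
      (∀ p ∈ barlowStacking 1 (Real.sqrt (2 / 3)) s, bondNbrs S (Ψ p) ⊆ Ψ '' contacts s p) →
      τ ≠ 0 → (∀ q ∈ barlowStacking 1 (Real.sqrt (2 / 3)) s, q + τ ∈ barlowStacking 1 (Real.sqrt (2 / 3)) s ∧ q - τ ∈ barlowStacking 1 (Real.sqrt (2 / 3)) s) → (∀ q ∈ barlowStacking 1 (Real.sqrt (2 / 3)) s, Ψ (q + τ) = Ψ q) →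
        ∀ p ∈ barlowStacking 1 (Real.sqrt (2 / 3)) s, ∃ K : ℝ, ∀ n : ℕ,
          (Set.ncard (windowBall S (Ψ p) n) : ℝ) ≤ K * ((n : ℝ) + 1) ^ 2)
    (h₆ : ∀ S : Set (EuclideanSpace ℝ (Fin 3)), GoodShells S → ∀ x ∈ S, ∀ n : ℕ, 12 ≤ n →
      ((n : ℝ) / 6) ^ 3 ≤ (Set.ncard (windowBall S x n) : ℝ)) :
    ∀ S : Set (EuclideanSpace ℝ (Fin 3)), S.Nonempty → GoodShells S → BarlowChart S := by
  intro S hne hG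
  obtain ⟨s, hs, Ψ, hcov⟩ := h₂ S hne hG (h₁ S hG)
  obtain ⟨hmaps, hsurj, hstar, hlink⟩ := hcov
  -- Step 1: `Ψ` is injective on the model (the growth descent).
  have hinj : Set.InjOn Ψ (barlowStacking 1 (Real.sqrt (2 / 3)) s) := by
    intro p hp p' hp' hpp'
    by_contra hne'
    obtain ⟨σ, ⟨hbij, hcontact⟩, hdeck, -, hfree⟩ :=
      h₃ S s Ψ hs ⟨hmaps, hsurj, hstar, hlink⟩ p hp p' hp' hpp' hne'
    -- the deck automorphism moves every site by graph distance ≥ 3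
    have hd1 : ∀ q ∈ barlowStacking 1 (Real.sqrt (2 / 3)) s, dist q (σ q) ≠ 1 := by
      intro q hq h1
      have hσq : σ q ∈ contacts s q := ⟨hbij.mapsTo hq, h1⟩
      have hb : Ψ (σ q) ∈ bondNbrs S (Ψ q) := (hstar q hq).mapsTo hσq
      have hpos : 0 < dist (Ψ q) (Ψ (σ q)) := hb.2.1
      rw [hdeck q hq, dist_self] at hpos
      exact lt_irrefl _ hpos
    have hd2 : ∀ q ∈ barlowStacking 1 (Real.sqrt (2 / 3)) s, ∀ m ∈ barlowStacking 1 (Real.sqrt (2 / 3)) s, dist q m = 1 → dist m (σ q) ≠ 1 := by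
      intro q hq m hm hqm h2
      have hq' : q ∈ contacts s m := ⟨hq, by rw [dist_comm]; exact hqm⟩
      have hσq : σ q ∈ contacts s m := ⟨hbij.mapsTo hq, h2⟩
      exact hfree q hq ((hstar m hm).injOn hσq hq' (hdeck q hq))
    obtain ⟨τ, hτ, hper, n₀, hiter⟩ := h₄ s σ hs ⟨hbij, hcontact⟩ hfree hd1 hd2
    -- `Ψ` is `τ`-invariant: iterate the deck relation
    have hiterB : ∀ k : ℕ, ∀ q ∈ barlowStacking 1 (Real.sqrt (2 / 3)) s, σ^[k] q ∈ barlowStacking 1 (Real.sqrt (2 / 3)) s ∧ Ψ (σ^[k] q) = Ψ q := by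
      intro k
      induction k with
      | zero => intro q hq; exact ⟨hq, rfl⟩
      | succ k ih =>
        intro q hq
        obtain ⟨hkq, hΨk⟩ := ih q hq
        refine ⟨?_, ?_⟩
        · rw [Function.iterate_succ_apply']
          exact hbij.mapsTo hkq
        · rw [Function.iterate_succ_apply', hdeck _ hkq, hΨk]
    have hΨτ : ∀ q ∈ barlowStacking 1 (Real.sqrt (2 / 3)) s, Ψ (q + τ) = Ψ q := by
      intro q hq
      rw [← hiter q hq]
      exact (hiterB n₀ q hq).2
    have hstarsurj : ∀ p ∈ barlowStacking 1 (Real.sqrt (2 / 3)) s, bondNbrs S (Ψ p) ⊆ Ψ '' contacts s p :=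
      fun p hp => (hstar p hp).surjOn
    obtain ⟨K, hK⟩ := h₅ S s Ψ τ hs hstarsurj hτ hper hΨτ p hp
    -- choose a radius beating both bounds
    obtain ⟨n, hn⟩ := exists_nat_gt (max 12 (216 * K + 216))
    have h12 : (12 : ℝ) < n := lt_of_le_of_lt (le_max_left _ _) hn
    have hn12 : 12 ≤ n := by exact_mod_cast h12.le
    have hKn : 216 * K + 216 < (n : ℝ) := lt_of_le_of_lt (le_max_right _ _) hn
    have hlow := h₆ S hG (Ψ p) (hmaps hp) n hn12
    have hup := hK n
    have hle : ((n : ℝ) / 6) ^ 3 ≤ K * ((n : ℝ) + 1) ^ 2 := hlow.trans hup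
    set N : ℝ := (n : ℝ) with hN
    have hN0 : (0 : ℝ) ≤ N := by positivity
    rcases le_or_gt K 0 with hK0 | hK0
    · have h1 : K * (N + 1) ^ 2 ≤ 0 := mul_nonpos_of_nonpos_of_nonneg hK0 (sq_nonneg _)
      have h2 : (0 : ℝ) < (N / 6) ^ 3 := by positivity
      linarith
    · have h1 : K * (N + 1) ^ 2 ≤ (N / 216 - 1) * (N + 1) ^ 2 :=
        mul_le_mul_of_nonneg_right (by linarith) (sq_nonneg _)
      have h2 : (N / 216 - 1) * (N + 1) ^ 2 < (N / 6) ^ 3 := by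
        nlinarith [sq_nonneg N, hN0]
      linarith
  -- Step 2: bijection and bond-faithfulness.
  refine ⟨s, hs, Ψ, ⟨hmaps, hinj, hsurj⟩, fun p hp q hq => ⟨fun hpq => ?_, fun hb => ?_⟩⟩
  · have hq' : q ∈ contacts s p := ⟨hq, hpq⟩
    exact ((hstar p hp).mapsTo hq').2
  · have hy : Ψ q ∈ bondNbrs S (Ψ p) := ⟨hmaps hq, hb⟩
    obtain ⟨q', hq', hqq'⟩ := (hstar p hp).surjOn hy
    have hqeq : q' = q := hinj hq'.1 hq hqq'
    rw [← hqeq]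
    exact hq'.2

/-- **SKELETON THEOREM — the crux `ShellsToBarlowChart` BY NAME from the six registered stubs.**
No hypotheses and no `sorry`: the seven stubs are landed theorems and the composition
`barlowChart_of_stubs` is kernel-checked, so this theorem closes the crux. -/
theorem ShellsToBarlowChart_of : ShellsToBarlowChart :=
  shellsToBarlowChart_iff_scaled.2
    (barlowChart_of_stubs Summit.AtomisticToContinuum.Crystallization.Theorems.PalmUnimodularRigidityShellsToBarlowChart.stub_localCharts
      (fun S hne hG hL => Summit.AtomisticToContinuum.Crystallization.Theorems.PalmUnimodularRigidityShellsToBarlowChart.stub_developCovering S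
        (Summit.AtomisticToContinuum.Crystallization.Theorems.PalmUnimodularRigidityShellsToBarlowChart.stub_transportSystem S hne hG hL))
      Summit.AtomisticToContinuum.Crystallization.Theorems.PalmUnimodularRigidityShellsToBarlowChart.stub_deckTransitive Summit.AtomisticToContinuum.Crystallization.Theorems.PalmUnimodularRigidityShellsToBarlowChart.stub_powerTranslation
      Summit.AtomisticToContinuum.Crystallization.Theorems.PalmUnimodularRigidityShellsToBarlowChart.stub_quotientGrowth Summit.AtomisticToContinuum.Crystallization.Theorems.PalmUnimodularRigidityShellsToBarlowChart.stub_cubicGrowth)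

end Summit.AtomisticToContinuum.Crystallization.Cruxes.ShellsToBarlowChart.DevelopTheModelGrowthDescent
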